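import Mathlib
import Summits.KontsevichZagierPeriods.Zeta5Search.ClassTypeGuardsO
import Summits.KontsevichZagierPeriods.Zeta5Search.ClassTypeGuardsI
import Summits.KontsevichZagierPeriods.Zeta5Search.CellKitPoints
import Summits.KontsevichZagierPeriods.Zeta5Search.CellKitAffine
import Summits.KontsevichZagierPeriods.Zeta5Search.AtlasRay4
import HarnessLib

/-!
# ζ(5) search — CLASS TYPE COVERS VI: the T1-map ray H1 (`b(n) = n·(34; 14,…,8) = bLin 8n 6n n`) — level regions and window wrappers (p3 g6)

HONEST FRAMING: systematic search; no irrationality claim unless certified.  Cell `pub-zeta5`, prover seat p3, generation 6.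

The class-type cover machine of files I–V (`ClassTypeCover`, `ClassTypeGuards`, `RecordRayLevels`, `ClassTypeGuardsO`, `ClassTypeGuardsI`)
is ray-independent except for the net-exponent REGIONS and the window facts.  This file supplies them for the census T1-map ray H1
(g8 class H1, direction `a = (7,13,9,12,11,15,17,12)`, dual ray `b(n) = n·(34; 14,13,12,11,10,9,8)`, written `bLin (8n) (6n) n` as in
P1's atlas machine and typer g16's `RayH1KernelAtlasWin*.bH1_bridge`; `b₀ = 34n`, `d = 25n`): the sixteen regions `neH_*`
(from `CellKitPoints.netExp_*V`), the typed-class constructors `h1Type_ne / h1Type_eq`, the window facts `h1_window`, THEOREM LB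
`h1_LB0`, and the wrappers `h1_LB / h1_J / h1_B / h1_O / h1_I` (`c ≤ v_p(Cas₇(b(n)))` from a cover and the decidable checks).
The machine-generated faces are `RayH1Letters*.lean` (census g30 KERNEL-LEDGER-H1 letters windows); consumption is the ray-kernel
frame of typer g16 (`RayKernelCell.cell_cert`).  Valuations of rationals; every exponent these feed stays `< 1` — no
irrationality content; no record is claimed.
-/

noncomputable section

open Finset

namespace Summit.KontsevichZagierPeriods.Zeta5Search.ClassTypeCover

open Summit.KontsevichZagierPeriods.Zeta5Search.ClusterValuation
open Summit.KontsevichZagierPeriods.Zeta5Search.CasoratianValuation (InPolytope shift casoratian)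
open Summit.KontsevichZagierPeriods.Zeta5Search.WedgeDictionary (dOf)
open Summit.KontsevichZagierPeriods.Zeta5Search.CellKit

section H1

variable {n p q x : ℕ}

/-! ### The sixteen net-exponent regions of `bLin (8n) (6n) n` -/

/-- `q < 8n`. -/
theorem neH_low (h : q < 8 * n) : netExp (bLin (8 * n) (6 * n) n) q = 1 := netExp_lowV h
/-- `[8n, 9n)`. -/
theorem neH_d1 (h : 8 * n ≤ q ∧ q < 9 * n) : netExp (bLin (8 * n) (6 * n) n) q = 0 :=
  netExp_lowerV (k := 1) (by norm_num) (by norm_num) (by omega) (by omega) (by norm_num)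
/-- `[9n, 10n)`. -/
theorem neH_d2 (h : 9 * n ≤ q ∧ q < 10 * n) : netExp (bLin (8 * n) (6 * n) n) q = -1 :=
  netExp_lowerV (k := 2) (by norm_num) (by norm_num) (by omega) (by omega) (by norm_num)
/-- `[10n, 11n)`. -/
theorem neH_d3 (h : 10 * n ≤ q ∧ q < 11 * n) : netExp (bLin (8 * n) (6 * n) n) q = -2 :=
  netExp_lowerV (k := 3) (by norm_num) (by norm_num) (by omega) (by omega) (by norm_num)
/-- `[11n, 12n)`. -/
theorem neH_d4 (h : 11 * n ≤ q ∧ q < 12 * n) : netExp (bLin (8 * n) (6 * n) n) q = -3 :=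
  netExp_lowerV (k := 4) (by norm_num) (by norm_num) (by omega) (by omega) (by norm_num)
/-- `[12n, 13n)`. -/
theorem neH_d5 (h : 12 * n ≤ q ∧ q < 13 * n) : netExp (bLin (8 * n) (6 * n) n) q = -4 :=
  netExp_lowerV (k := 5) (by norm_num) (by norm_num) (by omega) (by omega) (by norm_num)
/-- `[13n, 14n)`. -/
theorem neH_d6 (h : 13 * n ≤ q ∧ q < 14 * n) : netExp (bLin (8 * n) (6 * n) n) q = -5 :=
  netExp_lowerV (k := 6) (by norm_num) (by norm_num) (by omega) (by omega) (by norm_num)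
/-- The well `[14n, 20n]` off the centre `17n`. -/
theorem neH_well (h : 14 * n ≤ q ∧ q ≤ 20 * n ∧ 2 * q ≠ 34 * n) : netExp (bLin (8 * n) (6 * n) n) q = -6 :=
  netExp_wellV (by omega) (by omega) (by omega)
/-- The centre `q = 17n`. -/
theorem neH_cen (h : 2 * q = 34 * n) : netExp (bLin (8 * n) (6 * n) n) q = -5 := netExp_centreV (by omega)
/-- `(20n, 21n]`. -/
theorem neH_u6 (h : 20 * n < q ∧ q ≤ 21 * n) : netExp (bLin (8 * n) (6 * n) n) q = -5 :=
  netExp_upperV (k := 6) (by norm_num) (by norm_num) (by omega) (by omega) (by norm_num)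
/-- `(21n, 22n]`. -/
theorem neH_u5 (h : 21 * n < q ∧ q ≤ 22 * n) : netExp (bLin (8 * n) (6 * n) n) q = -4 :=
  netExp_upperV (k := 5) (by norm_num) (by norm_num) (by omega) (by omega) (by norm_num)
/-- `(22n, 23n]`. -/
theorem neH_u4 (h : 22 * n < q ∧ q ≤ 23 * n) : netExp (bLin (8 * n) (6 * n) n) q = -3 :=
  netExp_upperV (k := 4) (by norm_num) (by norm_num) (by omega) (by omega) (by norm_num)
/-- `(23n, 24n]`. -/
theorem neH_u3 (h : 23 * n < q ∧ q ≤ 24 * n) : netExp (bLin (8 * n) (6 * n) n) q = -2 :=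
  netExp_upperV (k := 3) (by norm_num) (by norm_num) (by omega) (by omega) (by norm_num)
/-- `(24n, 25n]`. -/
theorem neH_u2 (h : 24 * n < q ∧ q ≤ 25 * n) : netExp (bLin (8 * n) (6 * n) n) q = -1 :=
  netExp_upperV (k := 2) (by norm_num) (by norm_num) (by omega) (by omega) (by norm_num)
/-- `(25n, 26n]`. -/
theorem neH_u1 (h : 25 * n < q ∧ q ≤ 26 * n) : netExp (bLin (8 * n) (6 * n) n) q = 0 :=
  netExp_upperV (k := 1) (by norm_num) (by norm_num) (by omega) (by omega) (by norm_num)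
/-- `q > 26n`. -/
theorem neH_high (h : 26 * n < q) : netExp (bLin (8 * n) (6 * n) n) q = 1 := netExp_highV (by omega)

/-- `b₀ = 34n` over `ℤ` (cf. `AtlasRay4.b0_toNat` / `b0_int` for the `ℕ` forms). -/
theorem bH1lin_zero (n : ℕ) : bLin (8 * n) (6 * n) n 0 = 34 * n := by rw [AtlasRay4.b0_int]; push_cast; ring

variable [Fact p.Prime]

/-- Typed class on the ray H1, not self-conjugate. -/
theorem h1Type_ne (L : ℕ) {T : List ℤ} (hlen : T.length = L + 1) (hx : x < p) (hL : x + L * p ≤ 34 * n)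
    (hL' : 34 * n < x + L * p + p) (hlev : Levels (bLin (8 * n) (6 * n) n) x p T) (hne : 2 * x + L * p ≠ 34 * n) :
    IsType (bLin (8 * n) (6 * n) n) p x T false :=
  isType_of_ne (by rw [bH1lin_zero]; positivity) L hlen hx (by rw [AtlasRay4.b0_toNat]; exact hL)
    (by rw [AtlasRay4.b0_toNat]; exact hL') hlev (by rw [AtlasRay4.b0_toNat]; exact hne)

/-- Typed class on the ray H1, self-conjugate. -/
theorem h1Type_eq (L : ℕ) {T : List ℤ} (hlen : T.length = L + 1) (hx : x < p) (hL : x + L * p ≤ 34 * n)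
    (hL' : 34 * n < x + L * p + p) (hlev : Levels (bLin (8 * n) (6 * n) n) x p T) (heq : 2 * x + L * p = 34 * n) :
    IsType (bLin (8 * n) (6 * n) n) p x T true :=
  isType_of_eq (by rw [bH1lin_zero]; positivity) L hlen hx (by rw [AtlasRay4.b0_toNat]; exact hL)
    (by rw [AtlasRay4.b0_toNat]; exact hL') hlev (by rw [AtlasRay4.b0_toNat]; exact heq)

omit [Fact p.Prime] in
/-- The parity flag of `b₀ = 34n`: always even. -/
theorem oddFlag_bH1lin (n : ℕ) : decide (¬ (2 : ℤ) ∣ bLin (8 * n) (6 * n) n 0) = false := by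
  rw [bH1lin_zero, decide_eq_false_iff_not, not_not]; exact ⟨17 * n, by ring⟩

omit [Fact p.Prime] in
/-- The window facts of the ray H1 (`b₀ = 34n`, `d = 25n`). -/
theorem h1_window (hpd : p ≤ 25 * n) (hsq : 34 * n + 2 < p ^ 2) :
    (p : ℤ) ≤ bLin (8 * n) (6 * n) n 0 ∧ (p : ℤ) ≤ dOf (bLin (8 * n) (6 * n) n) ∧ (bLin (8 * n) (6 * n) n 0 + 2 : ℤ) < (p : ℤ) ^ 2 := by
  rw [bH1lin_zero, dOf_bLin]
  push_cast
  refine ⟨by exact_mod_cast (show p ≤ 34 * n by omega), by linarith [(by exact_mod_cast hpd : (p : ℤ) ≤ 25 * n)],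
    by exact_mod_cast hsq⟩

omit [Fact p.Prime] in
/-- THEOREM LB on the ray H1. -/
theorem h1_LB0 (hn : 1 ≤ n) (hpr : p.Prime) (hp5 : 5 ≤ p) (hpd : p ≤ 25 * n) (hsq : 34 * n + 2 < p ^ 2)
    (hne : casoratian (bLin (8 * n) (6 * n) n) 7 ≠ 0) :
    casLB (bLin (8 * n) (6 * n) n) p ≤ padicValRat p (casoratian (bLin (8 * n) (6 * n) n) 7) :=
  casoratianClassBound_holds _ 7 p (inPolytope_bLin (by omega)) (by norm_num) (by norm_num)
    (inPolytope_shift_bLin hn (by omega)) hpr hp5 (h1_window hpd hsq).2.2 hne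

omit [Fact p.Prime] in
/-- **H1 WINDOW BOUND by THEOREM LB** (cover + `checkLB`, `c ≤ A + B`, `c ≤ 0`). -/
theorem h1_LB (hn : 1 ≤ n) (hpr : p.Prime) (hp5 : 5 ≤ p) (hpd : p ≤ 25 * n) (hsq : 34 * n + 2 < p ^ 2)
    {TY : List (List ℤ × Bool)} (hcov : Cover (bLin (8 * n) (6 * n) n) p TY) {A B c : ℤ}
    (hLB : checkLB false TY A B = true) (hB1 : B ≤ 1) (hc : c ≤ A + B) (hc0 : c ≤ 0)
    (hne : casoratian (bLin (8 * n) (6 * n) n) 7 ≠ 0) : c ≤ padicValRat p (casoratian (bLin (8 * n) (6 * n) n) 7) := by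
  haveI : Fact p.Prime := ⟨hpr⟩
  obtain ⟨-, hpd', -⟩ := h1_window (n := n) hpd hsq
  have hv := h1_LB0 hn hpr hp5 hpd hsq hne
  rcases casLB_ge_of_cover hcov (by rw [oddFlag_bH1lin n]; exact hLB) hB1 hpd' with h0 | h
  · rw [h0] at hv; exact le_trans (by exact_mod_cast hc0) hv
  · linarith

omit [Fact p.Prime] in
/-- **H1 WINDOW BOUND by the LEMMA-D BONUS**. -/
theorem h1_J (hn : 1 ≤ n) (hpr : p.Prime) (hp5 : 5 ≤ p) (hpd : p ≤ 25 * n) (hsq : 34 * n + 2 < p ^ 2)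
    {TY : List (List ℤ × Bool)} (hcov : Cover (bLin (8 * n) (6 * n) n) p TY) {m B A' B' c : ℤ}
    (hLB : checkLB false TY m B = true) (hB1 : B ≤ 1) (hJ : checkJ false TY m = true)
    (hLBx : checkLBx false TY m A' B' = true) (hB1' : B' ≤ 1) (hc : c ≤ m + B + 1) (hc' : c ≤ A' + B') (hc0 : c ≤ 0)
    (hne : casoratian (bLin (8 * n) (6 * n) n) 7 ≠ 0) : c ≤ padicValRat p (casoratian (bLin (8 * n) (6 * n) n) 7) := by
  haveI : Fact p.Prime := ⟨hpr⟩
  obtain ⟨hpb, hpd', hwin⟩ := h1_window (n := n) hpd hsq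
  have hv := h1_LB0 hn hpr hp5 hpd hsq hne
  by_cases hreal : ∃ x, x < p ∧ 2 ≤ classPoleCount (bLin (8 * n) (6 * n) n) p x ∧ classExp (bLin (8 * n) (6 * n) n) p x = m
  · have hJ' := lemmaD_of_cover (inPolytope_bLin (by omega)) (by norm_num) (by norm_num) (inPolytope_shift_bLin hn (by omega))
      hpr hp5 hpb hpd' hwin hcov (by rw [oddFlag_bH1lin n]; exact hJ) hreal hne
    rcases casLB_ge_of_cover hcov (by rw [oddFlag_bH1lin n]; exact hLB) hB1 hpd' with h0 | h
    · rw [h0] at hv; exact le_trans (by exact_mod_cast hc0) hv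
    · linarith
  · rcases casLB_ge_of_cover_x hcov (by rw [oddFlag_bH1lin n]; exact hLBx) hB1' hpd' hreal with h0 | h
    · rw [h0] at hv; exact le_trans (by exact_mod_cast hc0) hv
    · linarith

omit [Fact p.Prime] in
/-- **H1 WINDOW BOUND by the DOUBLE-DROP BONUS**. -/
theorem h1_B (hn : 1 ≤ n) (hpr : p.Prime) (hp5 : 5 ≤ p) (hpd : p ≤ 25 * n) (hsq : 34 * n + 2 < p ^ 2)
    {TY : List (List ℤ × Bool)} (hcov : Cover (bLin (8 * n) (6 * n) n) p TY) {N : ℕ} (hN : 3 ≤ N) (hNe : Even N)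
    {B A' B' c : ℤ} (hLB : checkLB false TY (-(N : ℤ)) B = true) (hB1 : B ≤ 1) (hB : checkB false TY N = true)
    (hLBx : checkLBx false TY (-(N : ℤ)) A' B' = true) (hB1' : B' ≤ 1)
    (hc : c ≤ -(N : ℤ) + B + 2) (hc' : c ≤ A' + B') (hc0 : c ≤ 0)
    (hne : casoratian (bLin (8 * n) (6 * n) n) 7 ≠ 0) : c ≤ padicValRat p (casoratian (bLin (8 * n) (6 * n) n) 7) := by
  haveI : Fact p.Prime := ⟨hpr⟩
  obtain ⟨hpb, hpd', hwin⟩ := h1_window (n := n) hpd hsq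
  have hv := h1_LB0 hn hpr hp5 hpd hsq hne
  by_cases hreal : ∃ x, x < p ∧ 2 ≤ classPoleCount (bLin (8 * n) (6 * n) n) p x ∧
      classExp (bLin (8 * n) (6 * n) n) p x = -(N : ℤ)
  · have hB' := doubleDrop_of_cover (inPolytope_bLin (by omega)) (by norm_num) (by norm_num) (inPolytope_shift_bLin hn (by omega))
      hpr hp5 hpb hpd' hwin hcov hN hNe (by rw [oddFlag_bH1lin n]; exact hB) hreal hne
    rcases casLB_ge_of_cover hcov (by rw [oddFlag_bH1lin n]; exact hLB) hB1 hpd' with h0 | h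
    · rw [h0] at hv; exact le_trans (by exact_mod_cast hc0) hv
    · linarith
  · rcases casLB_ge_of_cover_x hcov (by rw [oddFlag_bH1lin n]; exact hLBx) hB1' hpd' hreal with h0 | h
    · rw [h0] at hv; exact le_trans (by exact_mod_cast hc0) hv
    · linarith

omit [Fact p.Prime] in
/-- **H1 WINDOW BOUND by the COLLINEARITY RUNG** (`N ≥ 3` odd, moment range `(N − 1)p ≤ 50n + 1`). -/
theorem h1_O (hn : 1 ≤ n) (hpr : p.Prime) (hp5 : 5 ≤ p) (hpd : p ≤ 25 * n) (hsq : 34 * n + 2 < p ^ 2)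
    {TY : List (List ℤ × Bool)} (hcov : Cover (bLin (8 * n) (6 * n) n) p TY) {N : ℕ} (hN : 3 ≤ N) (hodd : N % 2 = 1)
    (hrange : (N - 1) * p ≤ 50 * n + 1) {K₁ K₂ : Bool × List ℤ} {B A' B' c : ℤ}
    (hLB : checkLB false TY (-(N : ℤ)) B = true) (hB1 : B ≤ 1) (hO : checkO false TY N K₁ K₂ = true)
    (hLBx : checkLBx false TY (-(N : ℤ)) A' B' = true) (hB1' : B' ≤ 1)
    (hc : c ≤ -(N : ℤ) + B + 1) (hc' : c ≤ A' + B') (hc0 : c ≤ 0)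
    (hne : casoratian (bLin (8 * n) (6 * n) n) 7 ≠ 0) : c ≤ padicValRat p (casoratian (bLin (8 * n) (6 * n) n) 7) := by
  haveI : Fact p.Prime := ⟨hpr⟩
  obtain ⟨hpb, hpd', hwin⟩ := h1_window (n := n) hpd hsq
  have hv := h1_LB0 hn hpr hp5 hpd hsq hne
  have hrange' : ((N : ℤ) - 1) * p + 2 ≤ 2 * dOf (bLin (8 * n) (6 * n) n) + 3 := by
    rw [dOf_bLin]
    push_cast
    have h1 : 1 ≤ N := by omega
    have h2 : (((N - 1) * p : ℕ) : ℤ) ≤ 50 * n + 1 := by exact_mod_cast hrange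
    push_cast [Nat.cast_sub h1] at h2
    nlinarith
  by_cases hreal : ∃ x, x < p ∧ 2 ≤ classPoleCount (bLin (8 * n) (6 * n) n) p x ∧
      classExp (bLin (8 * n) (6 * n) n) p x = -(N : ℤ)
  · have hO' := rungO_of_cover (inPolytope_bLin (by omega)) (by norm_num) (by norm_num) (inPolytope_shift_bLin hn (by omega))
      hpr hp5 hpb hpd' hwin hcov hN hodd hrange' (by rw [oddFlag_bH1lin n]; exact hO) hreal hne
    rcases casLB_ge_of_cover hcov (by rw [oddFlag_bH1lin n]; exact hLB) hB1 hpd' with h0 | h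
    · rw [h0] at hv; exact le_trans (by exact_mod_cast hc0) hv
    · linarith
  · rcases casLB_ge_of_cover_x hcov (by rw [oddFlag_bH1lin n]; exact hLBx) hB1' hpd' hreal with h0 | h
    · rw [h0] at hv; exact le_trans (by exact_mod_cast hc0) hv
    · linarith

omit [Fact p.Prime] in
/-- **H1 WINDOW BOUND by LAW A3** (`M ≥ 6` even, `T` palindromic, `c ≤ 6 − 2M`). -/
theorem h1_I (hn : 1 ≤ n) (hpr : p.Prime) (hp5 : 5 ≤ p) (hpd : p ≤ 25 * n) (hsq : 34 * n + 2 < p ^ 2)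
    {TY : List (List ℤ × Bool)} (hcov : Cover (bLin (8 * n) (6 * n) n) p TY) {M : ℕ} (hM : 6 ≤ M) (hMe : Even M)
    {T : List ℤ} (hT : T.reverse = T) (hI : checkI false TY M T = true) {c : ℤ} (hc : c ≤ 6 - 2 * M)
    (hne : casoratian (bLin (8 * n) (6 * n) n) 7 ≠ 0) : c ≤ padicValRat p (casoratian (bLin (8 * n) (6 * n) n) 7) := by
  obtain ⟨hpb, -, hwin⟩ := h1_window (n := n) hpd hsq
  have h := lawA3_of_cover (inPolytope_bLin (by omega)) (inPolytope_shift_bLin hn (by omega)) (by norm_num) (by norm_num)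
    hpr hp5 hpb hwin hcov hM hMe hT (by rw [oddFlag_bH1lin n]; exact hI) hne
  linarith

end H1

end Summit.KontsevichZagierPeriods.Zeta5Search.ClassTypeCover
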